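import Literature.AnabelianGeometry.Anabelioids.FiniteEtaleLocalDictionaryStabilizer
import Mathlib.CategoryTheory.Galois.Topology
import HarnessLib

/-!
# Anabelioids: an equivalence induces an isomorphism of fundamental groups ([GeoAn] §1.1)

Mochizuki, *The geometry of anabelioids*, Publ. RIMS **40** (2004), §1.1, Def. 1.1.2 (i)–(ii)
p. 10 [cite: MochizukiGeoAn2004, Def. 1.1.2(ii) p.10]: an isomorphism (equivalence) of connected
anabelioids `φ : X ⥲ Y` induces an isomorphism `π₁(X, β) ⥲ π₁(Y, φ ∘ β)`.  In the tree's language: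
for an equivalence `P : Y ⥤ X` and a basepoint `F` of `X`, whiskering `pi1Map P F : Aut F → Aut (P ⋙ F)`
is injective (`pi1Map_injective_of_isEquivalence`), surjective
(`pi1Map_surjective_of_isEquivalence`, L6-t17), continuous (`continuous_pi1Map'`), hence — `Aut F`
being profinite — an isomorphism of topological groups
(`exists_continuousMulEquiv_aut_of_isEquivalence`).  Used to transport fundamental groups along the
comparison equivalences between the presentations of a semi-graph of anabelioids.  Proof-only file.
-/

namespace Literature.AnabelianGeometry.Anabelioids

open CategoryTheory CategoryTheory.Limits CategoryTheory.PreGaloisCategory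

universe u₁ u₂ u₃ u₄ w

section

variable {X : Type u₁} [Category.{u₂} X] {Y : Type u₃} [Category.{u₄} Y]

/-- Whiskering along an equivalence is injective on automorphisms of a basepoint (an automorphism
trivial on the essential image is trivial). [cite: MochizukiGeoAn2004, Def. 1.1.2(ii) p.10] -/
theorem pi1Map_injective_of_isEquivalence (P : Y ⥤ X) [P.IsEquivalence] (F : X ⥤ FintypeCat.{w}) :
    Function.Injective (pi1Map P F) := by
  rw [injective_iff_map_eq_one]
  intro σ hσ
  apply Iso.ext
  apply NatTrans.ext
  funext A
  -- `A ≅ P (P⁻¹ A)`; naturality of `σ` along this isomorphism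
  let e : P.obj (P.objPreimage A) ≅ A := P.objObjPreimageIso A
  have h1 : σ.hom.app (P.obj (P.objPreimage A)) = 𝟙 _ := by
    have := congrArg (fun τ : Aut (P ⋙ F) => τ.hom.app (P.objPreimage A)) hσ
    exact this
  have nat := σ.hom.naturality e.hom
  rw [h1, Category.id_comp] at nat
  -- nat : F.map e.hom = F.map e.hom ≫ σ.hom.app A
  have h2 : σ.hom.app A = 𝟙 _ := by
    have h3 : F.map e.hom ≫ σ.hom.app A = F.map e.hom ≫ 𝟙 _ := by
      rw [Category.comp_id]
      exact nat
    exact (cancel_epi (F.map e.hom)).mp h3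
  rw [h2]
  rfl

/-- `π₁(P)` is continuous (Mathlib's topology on `Aut F` is induced from `∏_B Aut (F B)`).
[cite: MochizukiGeoAn2004, Def. 1.1.2(ii) p.10] -/
theorem continuous_pi1Map' (P : Y ⥤ X) (F : X ⥤ FintypeCat.{w}) : Continuous (pi1Map P F) := by
  refine continuous_induced_rng.2 (continuous_pi fun B => ?_)
  have h1 : Continuous (autEmbedding F) := continuous_induced_dom
  have h2 : Continuous (fun t : (∀ A : X, Aut (F.obj A)) => t (P.obj B)) := continuous_apply (P.obj B)
  exact h2.comp h1

/-- **An equivalence of connected anabelioids induces an isomorphism of (topological) fundamental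
groups**: for an equivalence `P : Y ⥤ X` and a basepoint `F` of the Galois category `X`,
`π₁(P) : Aut F ≃ₜ* Aut (P ⋙ F)`. [cite: MochizukiGeoAn2004, Def. 1.1.2(ii) p.10] -/
theorem exists_continuousMulEquiv_aut_of_isEquivalence [GaloisCategory X] (P : Y ⥤ X)
    [P.IsEquivalence] (F : X ⥤ FintypeCat.{u₂}) [FiberFunctor F] :
    ∃ e : Aut F ≃ₜ* Aut (P ⋙ F), ∀ σ, e σ = pi1Map P F σ := by
  let e₀ : Aut F ≃* Aut (P ⋙ F) := MulEquiv.ofBijective (pi1Map P F)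
    ⟨pi1Map_injective_of_isEquivalence P F, pi1Map_surjective_of_isEquivalence P F⟩
  have he₀ : Continuous e₀ := continuous_pi1Map' P F
  let eₜ : Aut F ≃ₜ Aut (P ⋙ F) := Continuous.homeoOfEquivCompactToT2 (f := e₀.toEquiv) he₀
  exact ⟨{ e₀ with continuous_toFun := he₀, continuous_invFun := eₜ.symm.continuous }, fun σ => rfl⟩

end

end Literature.AnabelianGeometry.Anabelioids
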